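import Literature.AlgebraicGeometry.HodgeTheory.HomComplexPushforward
import Literature.AlgebraicGeometry.Modules.SheafHomPullback
import HarnessLib

/-!
# The internal Hom complex and pull-back: the comparison `f^*• 𝓗om•(E•, L•) ⟶ 𝓗om•(f^*• E•, f^*• L•)`

Layer `Literature/AlgebraicGeometry/HodgeTheory`; the pull-back twin of `HomComplexPushforward.lean` (which treats `ε_*` for an
ISOMORPHISM of schemes). For ANY morphism of schemes `f : X ⟶ Y` and cochain complexes `E•`, `L•` of `𝒪_Y`-modules
(`f^* = Scheme.Modules.pullback f`, termwise on complexes):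

* `pullback_map_sheafHomMapLeft_comp_sheafHomPullbackComparison` — the module-level base-change morphism
  `f^* 𝓗om(A, M) ⟶ 𝓗om(f^*A, f^*M)` (`Modules/SheafHomPullback`) is natural in the FIRST (contravariant) variable too
  (for the second variable see `sheafHomPullbackComparison_naturality` there);
* `homBicomplexPullbackHom f E L` — the Hom BICOMPLEX comparison `f^*••(𝓗om(E^{-i}, L^q))_{q,i} ⟶ (𝓗om((f^*E)^{-i}, (f^*L)^q))_{q,i}`,
  componentwise the module-level comparison (horizontal differentials by naturality in `M`, signed vertical ones by naturality
  in `A`);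
* **`homComplexPullbackHom f E L : f^*• 𝓗om•(E•, L•) ⟶ 𝓗om•(f^*• E•, f^*• L•)`** — `f^*` commutes with the coproducts of the
  total complex (a left adjoint; `Literature.Algebra.Homology.mapTotalIso`) followed by `total.map` of the bicomplex comparison;
  on summands `f^*(ι_{q,i}) ≫ (…)_n = c_{q,i} ≫ ι'_{q,i}` (`map_ι_comp_homComplexPullbackHom_f`).

Everything is a construction or a proved lemma; no named facts. What is NOT here: the statement that the comparison is an
isomorphism (quasi-isomorphism) for `E•` termwise finite locally free; the naturality in `L•` as a `NatTrans` of the functors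
`𝓗om•(E•, –) ⋙ f^*•` and `f^*• ⋙ 𝓗om•(f^*•E•, –)` with its shift compatibility (Summits side, on the venture's `homFunctor`).
Motivation: step (Q1) of the typing plan of the library item (L2) `SigmaPullbackCompat` (crux stmt-HodgeConjecture-26512, support
line «sigma-descent-along-q»); nothing of that crux is asserted here.

References: U. Görtz, T. Wedhorn, *Algebraic Geometry I*, 2nd ed. (2020), (7.8.3) and Exercise 7.20 (a) [GortzWedhorn2020];
The Stacks project, *More on Algebra*, Section «Hom complexes», and Tag 01CM [StacksProject]; C. A. Weibel (1994), §1.2 (1.2.6),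
2.7.4–2.7.5 [Weibel1994].
-/

noncomputable section

-- `TopCat.Presheaf`/`Scheme.Modules`/`GradedObject` are not reducible.
set_option backward.isDefEq.respectTransparency false

open CategoryTheory CategoryTheory.Category CategoryTheory.Limits AlgebraicGeometry Opposite

universe u

namespace Literature.AlgebraicGeometry.HodgeTheory

open Literature.AlgebraicGeometry.Modules Literature.Algebra.Homology

variable {X Y : Scheme.{u}} (f : X ⟶ Y)

/-! ## §1 Naturality of the module-level comparison in the first variable -/

/-- `𝓗om(g, M) ≫ (φ ↦ f^*φ) = (φ ↦ f^*φ) ≫ f_* 𝓗om(f^*g, f^*M)`: on sections `f^*(g|_U ≫ ψ) = (f^*g)|_{f⁻¹U} ≫ f^*ψ`.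
[cite: StacksProject, Tag 01CM] [cite: GortzWedhorn2020, (7.8.3) and Exercise 7.20 (a)] -/
theorem sheafHomMapLeft_comp_sheafHomPullbackTransposeHom {A₁ A₂ : Y.Modules} (g : A₁ ⟶ A₂) (M : Y.Modules) :
    sheafHomMapLeft g M ≫ sheafHomPullbackTransposeHom f A₁ M =
      sheafHomPullbackTransposeHom f A₂ M ≫
        (Scheme.Modules.pushforward f).map
          (sheafHomMapLeft ((Scheme.Modules.pullback f).map g) ((Scheme.Modules.pullback f).obj M)) := by
  apply Scheme.Modules.hom_ext
  intro U
  ext ψ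
  change pullbackHomOver f ((SheafOfModules.overFunctor _ U).map g ≫ ψ) =
    (SheafOfModules.overFunctor _ (f ⁻¹ᵁ U)).map ((Scheme.Modules.pullback f).map g) ≫ pullbackHomOver f ψ
  rw [pullbackHomOver_comp, pullbackHomOver_over_map]

/-- **Naturality of `f^* 𝓗om(A, M) ⟶ 𝓗om(f^*A, f^*M)` in `A`**: `f^* 𝓗om(g, M) ≫ c_{A₁} = c_{A₂} ≫ 𝓗om(f^*g, f^*M)`.
[cite: StacksProject, Tag 01CM] [cite: GortzWedhorn2020, (7.8.3) and Exercise 7.20 (a)] -/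
theorem pullback_map_sheafHomMapLeft_comp_sheafHomPullbackComparison {A₁ A₂ : Y.Modules} (g : A₁ ⟶ A₂) (M : Y.Modules) :
    (Scheme.Modules.pullback f).map (sheafHomMapLeft g M) ≫ sheafHomPullbackComparison f A₁ M =
      sheafHomPullbackComparison f A₂ M ≫
        sheafHomMapLeft ((Scheme.Modules.pullback f).map g) ((Scheme.Modules.pullback f).obj M) := by
  apply ((Scheme.Modules.pullbackPushforwardAdjunction f).homEquiv _ _).injective
  rw [Adjunction.homEquiv_naturality_left, Adjunction.homEquiv_naturality_right, homEquiv_sheafHomPullbackComparison,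
    homEquiv_sheafHomPullbackComparison, sheafHomMapLeft_comp_sheafHomPullbackTransposeHom]

/-! ## §2 The Hom bicomplex and the Hom complex along `f^*` -/

variable (E L : CochainComplex Y.Modules ℤ)

/-- **The Hom bicomplex along `f^*`**: `f^*(𝓗om(E^{-i}, L^q)) ⟶ 𝓗om((f^*E)^{-i}, (f^*L)^q)` componentwise
(`sheafHomPullbackComparison`), as a morphism of bicomplexes `f^*••(homBicomplex Y E L) ⟶ homBicomplex X (f^*E) (f^*L)` — horizontal
differentials by naturality in the second variable, vertical (signed dual) differentials by naturality in the first variable.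
[cite: StacksProject, More on Algebra, Section «Hom complexes»] [cite: GortzWedhorn2020, (7.8.3) and Exercise 7.20 (a)] -/
def homBicomplexPullbackHom :
    mapBicomplex (Scheme.Modules.pullback f) (homBicomplex Y E L) ⟶
      homBicomplex X (((Scheme.Modules.pullback f).mapHomologicalComplex (ComplexShape.up ℤ)).obj E)
        (((Scheme.Modules.pullback f).mapHomologicalComplex (ComplexShape.up ℤ)).obj L) where
  f q :=
    { f := fun i => sheafHomPullbackComparison f (E.X (-i)) (L.X q)
      comm' := fun i i' _ => by
        change sheafHomPullbackComparison f (E.X (-i)) (L.X q) ≫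
            sheafHomMapLeft (((i').negOnePow : ℤˣ) • (Scheme.Modules.pullback f).map (E.d (-i') (-i)))
              ((Scheme.Modules.pullback f).obj (L.X q)) =
          (Scheme.Modules.pullback f).map (sheafHomMapLeft (((i').negOnePow : ℤˣ) • E.d (-i') (-i)) (L.X q)) ≫
            sheafHomPullbackComparison f (E.X (-i')) (L.X q)
        rw [sheafHomMapLeft_units_smul, sheafHomMapLeft_units_smul, Units.smul_def, Units.smul_def, Functor.map_zsmul,
          Preadditive.comp_zsmul, Preadditive.zsmul_comp, pullback_map_sheafHomMapLeft_comp_sheafHomPullbackComparison] }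
  comm' q q' _ := by
    refine HomologicalComplex.hom_ext _ _ fun i => ?_
    change sheafHomPullbackComparison f (E.X (-i)) (L.X q) ≫
        sheafHomMap ((Scheme.Modules.pullback f).obj (E.X (-i))) ((Scheme.Modules.pullback f).map (L.d q q')) =
      (Scheme.Modules.pullback f).map (sheafHomMap (E.X (-i)) (L.d q q')) ≫ sheafHomPullbackComparison f (E.X (-i)) (L.X q')
    exact (sheafHomPullbackComparison_naturality f (E.X (-i)) (L.d q q')).symm

/-- Components of the bicomplex comparison. [cite: StacksProject, More on Algebra, Section «Hom complexes»] -/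
theorem homBicomplexPullbackHom_f_f (q i : ℤ) :
    ((homBicomplexPullbackHom f E L).f q).f i = sheafHomPullbackComparison f (E.X (-i)) (L.X q) := rfl

/-- **The internal Hom complex along a pull-back**: `f^*• 𝓗om•(E•, L•) ⟶ 𝓗om•(f^*• E•, f^*• L•)` — `f^*` (a left adjoint) preserves
the coproducts of the total complex (`mapTotalIso`), then `total.map` of the bicomplex comparison `homBicomplexPullbackHom`.
[cite: StacksProject, More on Algebra, Section «Hom complexes»] [cite: Weibel1994, §1.2, 1.2.6 and 2.7.4–2.7.5]
[cite: GortzWedhorn2020, (7.8.3) and Exercise 7.20 (a)] -/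
def homComplexPullbackHom :
    ((Scheme.Modules.pullback f).mapHomologicalComplex (ComplexShape.up ℤ)).obj (homComplex Y E L) ⟶
      homComplex X (((Scheme.Modules.pullback f).mapHomologicalComplex (ComplexShape.up ℤ)).obj E)
        (((Scheme.Modules.pullback f).mapHomologicalComplex (ComplexShape.up ℤ)).obj L) :=
  haveI : PreservesColimitsOfSize.{u, u} (Scheme.Modules.pullback f) :=
    (Scheme.Modules.pullbackPushforwardAdjunction f).leftAdjoint_preservesColimits
  (mapTotalIso (Scheme.Modules.pullback f) (homBicomplex Y E L) (ComplexShape.up ℤ)).inv ≫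
    HomologicalComplex₂.total.map (homBicomplexPullbackHom f E L) (ComplexShape.up ℤ)

/-- **On summands**: `f^*(ι_{q,i}) ≫ (homComplexPullbackHom)_n = (f^* 𝓗om(E^{-i}, L^q) ⟶ 𝓗om(f^*E^{-i}, f^*L^q)) ≫ ι'_{q,i}` —
the comparison is the module-level `sheafHomPullbackComparison` summand by summand.
[cite: StacksProject, More on Algebra, Section «Hom complexes»] [cite: Weibel1994, §1.2, 1.2.6] -/
theorem map_ι_comp_homComplexPullbackHom_f (q i n : ℤ) (h : q + i = n) :
    (Scheme.Modules.pullback f).map (HomComplex.ι Y E L q i n h) ≫ (homComplexPullbackHom f E L).f n =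
      sheafHomPullbackComparison f (E.X (-i)) (L.X q) ≫
        HomComplex.ι X (((Scheme.Modules.pullback f).mapHomologicalComplex (ComplexShape.up ℤ)).obj E)
          (((Scheme.Modules.pullback f).mapHomologicalComplex (ComplexShape.up ℤ)).obj L) q i n h := by
  haveI : PreservesColimitsOfSize.{u, u} (Scheme.Modules.pullback f) :=
    (Scheme.Modules.pullbackPushforwardAdjunction f).leftAdjoint_preservesColimits
  rw [homComplexPullbackHom, HomologicalComplex.comp_f]
  have hι : (Scheme.Modules.pullback f).map (HomComplex.ι Y E L q i n h) ≫
      (mapTotalIso (Scheme.Modules.pullback f) (homBicomplex Y E L) (ComplexShape.up ℤ)).inv.f n =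
      (mapBicomplex (Scheme.Modules.pullback f) (homBicomplex Y E L)).ιTotal (ComplexShape.up ℤ) q i n h := by
    rw [← ιTotal_mapTotalIso_hom (Scheme.Modules.pullback f) (homBicomplex Y E L) (ComplexShape.up ℤ) q i n h, Category.assoc,
      ← HomologicalComplex.comp_f, Iso.hom_inv_id, HomologicalComplex.id_f, Category.comp_id]
  rw [← Category.assoc, hι, HomologicalComplex₂.ιTotal_map, homBicomplexPullbackHom_f_f]

/-- **A morphism out of `f^*(𝓗om•(E, L)^n)` is determined by its compositions with the `f^*(ι_{q,i})`** (`q + i = n`):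
`f^*` preserves the coproduct `∐_{q+i=n} 𝓗om(E^{-i}, L^q)`. [cite: Weibel1994, §1.2, 1.2.6 and §2.6] -/
theorem pullback_ι_hom_ext {n : ℤ} {T : X.Modules}
    {a b : (Scheme.Modules.pullback f).obj ((homComplex Y E L).X n) ⟶ T}
    (h : ∀ (q i : ℤ) (hqi : q + i = n),
      (Scheme.Modules.pullback f).map (HomComplex.ι Y E L q i n hqi) ≫ a =
        (Scheme.Modules.pullback f).map (HomComplex.ι Y E L q i n hqi) ≫ b) :
    a = b := by
  haveI : PreservesColimitsOfSize.{u, u} (Scheme.Modules.pullback f) :=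
    (Scheme.Modules.pullbackPushforwardAdjunction f).leftAdjoint_preservesColimits
  rw [← cancel_epi ((mapTotalIso (Scheme.Modules.pullback f) (homBicomplex Y E L) (ComplexShape.up ℤ)).hom.f n)]
  apply HomologicalComplex₂.total.hom_ext
  intro q i hqi
  simp only [← Category.assoc]
  rw [ιTotal_mapTotalIso_hom]
  exact h q i hqi

/-- **Naturality of `homComplexPullbackHom` in `L•`**: for a chain map `φ : L ⟶ L'`,
`f^*•(𝓗om•(E, φ)) ≫ (…)_{L'} = (…)_L ≫ 𝓗om•(f^*•E, f^*•φ)` (summand by summand: naturality of the module-level comparison in `M`).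
[cite: StacksProject, More on Algebra, Section «Hom complexes»] -/
theorem homComplexPullbackHom_naturality {L L' : CochainComplex Y.Modules ℤ} (φ : L ⟶ L') :
    ((Scheme.Modules.pullback f).mapHomologicalComplex (ComplexShape.up ℤ)).map (HomComplex.map Y E φ) ≫
        homComplexPullbackHom f E L' =
      homComplexPullbackHom f E L ≫
        HomComplex.map X (((Scheme.Modules.pullback f).mapHomologicalComplex (ComplexShape.up ℤ)).obj E)
          (((Scheme.Modules.pullback f).mapHomologicalComplex (ComplexShape.up ℤ)).map φ) := by
  refine HomologicalComplex.hom_ext _ _ fun n => pullback_ι_hom_ext f E L fun q i hqi => ?_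
  rw [HomologicalComplex.comp_f, HomologicalComplex.comp_f, Functor.mapHomologicalComplex_map_f, ← Functor.map_comp_assoc,
    HomComplex.ι_map, Functor.map_comp_assoc, map_ι_comp_homComplexPullbackHom_f,
    reassoc_of% (map_ι_comp_homComplexPullbackHom_f f E L q i n hqi), HomComplex.ι_map, Functor.mapHomologicalComplex_map_f,
    ← Category.assoc, sheafHomPullbackComparison_naturality, Category.assoc]
  rfl

end Literature.AlgebraicGeometry.HodgeTheory

end
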